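import Mathlib
import HarnessLib

/-!
# The Schwarzschild tortoise (Regge–Wheeler) coordinate and tortoise radius functions

The Regge–Wheeler coordinate of the Schwarzschild exterior of mass `M` is
`r* = r + 2M log(r − 2M) − 3M − 2M log M` (Dafermos–Rodnianski, *Lectures on black holes and
linear waves*, App. F.2, normalised so that `r* = 0` at the photon sphere `r = 3M`); in the chart
`(t, r*) ∈ ℝ²` the metric is `−(1 − 2M/r)(−dt² + dr*²) + r² dσ` with `r` defined implicitly, and
`dr/dr* = 1 − 2M/r`.  The `1+1` reduction of linear waves on Schwarzschild (Regge–Wheeler /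
Zerilli equations, `ReggeWheelerChannels.lean`) lives on the tortoise line and needs the inverse
function `r = r(x)`.

Contents (namespace `Literature.Geometry.Lorentzian.ReggeWheeler`):

* `tortoiseCoord M ρ` — the normalised tortoise coordinate `r*(ρ)`, its derivative
  `1 + 2M/(ρ − 2M) = (1 − 2M/ρ)⁻¹`, strict monotonicity and injectivity on `(2M, ∞)`;
* `IsTortoiseRadius M r xc` — **tortoise radius function with the photon sphere at `xc`**:
  `r > 2M`, `dr/dx = 1 − 2M/r`, `r(xc) = 3M` (literally the hypothesis block of the photon-sphere
  channel items of route `PhotonSphereChannels` of the Final State Conjecture), and its calculus: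
  `M > 0`, `r > 0`, `0 < r' < 1`, `C¹`, strict monotonicity, the **tortoise identity**
  `r*(r(x)) = x − xc` (`IsTortoiseRadius.tortoiseCoord_eq`), **uniqueness**
  (`IsTortoiseRadius.unique`), recentring (`comp_sub_add`), and the end behaviour `r → 2M` as
  `x → −∞` (event horizon), `r → +∞` as `x → +∞`.

* **Existence** (`exists_isTortoiseRadius`, `existsUnique_isTortoiseRadius`): the explicit
  `tortoiseRadius hM xc x = 2M + exp(g⁻¹(x − xc))`, `g(s) = r*(2M + eˢ) = eˢ + 2Ms − M − 2M log M`
  a strictly increasing bijection of `ℝ`.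

Not here: the asymptotics `r = x − 2M log x + O(1)` (`x → +∞`), `r − 2M ≍ e^{x/2M}` (`x → −∞`).
The Kerr analogue (`dR/dx = Δ/(R² + a²)`, no photon-sphere normalisation) is
`Kerr.IsTortoiseRadius` in `KerrTortoiseRadius.lean`; for `a = 0` the two notions agree up to the
normalisation `r(xc) = 3M`.

## References

* M. Dafermos, I. Rodnianski, *Lectures on black holes and linear waves*, arXiv:0811.0354, Clay
  Math. Proc. 17 (2013), App. F.2 "Regge–Wheeler coordinates" (key `DafermosRodnianski2008`).
* T. Regge, J. A. Wheeler, Phys. Rev. 108 (1957) 1063–1069 (the original tortoise substitution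
  `dr* = dr/(1 − 2M/r)`; key `ReggeWheeler1957`).
-/

noncomputable section

open Filter Set
open scoped Topology

namespace Literature.Geometry.Lorentzian

namespace ReggeWheeler

/-! ### The tortoise coordinate and tortoise radius functions -/

/-- The **Schwarzschild tortoise (Regge–Wheeler) coordinate**, normalised at the photon sphere:
`r*(ρ) = ρ + 2M log(ρ − 2M) − 3M − 2M log M`, so that `dr*/dρ = (1 − 2M/ρ)⁻¹` on `ρ > 2M` and
`r*(3M) = 0`. (Junk values from `Real.log` off `ρ > 2M`.)
[cite: DafermosRodnianski2008, App. F.2] -/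
def tortoiseCoord (M ρ : ℝ) : ℝ :=
  ρ + 2 * M * Real.log (ρ - 2 * M) - 3 * M - 2 * M * Real.log M

/-- `r*(3M) = 0`: the photon sphere sits at the origin of the tortoise line.
[cite: DafermosRodnianski2008, App. F.2] -/
@[simp]
theorem tortoiseCoord_photonSphere (M : ℝ) : tortoiseCoord M (3 * M) = 0 := by
  unfold tortoiseCoord
  rw [show 3 * M - 2 * M = M by ring]
  ring

/-- `dr*/dρ = 1 + 2M/(ρ − 2M)` (`= ρ/(ρ − 2M) = (1 − 2M/ρ)⁻¹`) for `ρ ≠ 2M`. [folklore] -/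
theorem hasDerivAt_tortoiseCoord (M : ℝ) {ρ : ℝ} (hρ : ρ - 2 * M ≠ 0) :
    HasDerivAt (tortoiseCoord M) (1 + 2 * M * (1 / (ρ - 2 * M))) ρ := by
  have h1 : HasDerivAt (fun ρ : ℝ ↦ ρ - 2 * M) 1 ρ := (hasDerivAt_id' ρ).sub_const _
  have h2 := (h1.log hρ).const_mul (2 * M)
  have h3 := (((hasDerivAt_id' ρ).add h2).sub_const (3 * M)).sub_const (2 * M * Real.log M)
  exact h3

/-- `r*` is strictly increasing on `(2M, ∞)` when `M ≥ 0`. [folklore] -/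
theorem strictMonoOn_tortoiseCoord {M : ℝ} (hM : 0 ≤ M) :
    StrictMonoOn (tortoiseCoord M) (Ioi (2 * M)) := by
  intro a ha b hb hab
  have ha' : 0 < a - 2 * M := sub_pos.2 ha
  have hlog : Real.log (a - 2 * M) ≤ Real.log (b - 2 * M) :=
    Real.log_le_log ha' (by linarith)
  have h2 : 2 * M * Real.log (a - 2 * M) ≤ 2 * M * Real.log (b - 2 * M) :=
    mul_le_mul_of_nonneg_left hlog (by linarith)
  unfold tortoiseCoord
  linarith

/-- `r*` is injective on `(2M, ∞)` when `M ≥ 0`. [folklore] -/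
theorem injOn_tortoiseCoord {M : ℝ} (hM : 0 ≤ M) : InjOn (tortoiseCoord M) (Ioi (2 * M)) :=
  (strictMonoOn_tortoiseCoord hM).injOn

/-- **Tortoise radius function with the photon sphere at `xc`.** `r : ℝ → ℝ` is the
Schwarzschild area radius read along the tortoise line: `r > 2M`, `dr/dx = 1 − 2M/r`, and
`r(xc) = 3M`; equivalently (`IsTortoiseRadius.tortoiseCoord_eq`, `.unique`) `r` is the inverse of
`ρ ↦ xc + r*(ρ)`.  This is the hypothesis block `(∀ x, 2M < r x) → (∀ x, HasDerivAt r (1 − 2M/r x) x)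
→ r xc = 3M` of the photon-sphere channel items. [cite: DafermosRodnianski2008, App. F.2] -/
structure IsTortoiseRadius (M : ℝ) (r : ℝ → ℝ) (xc : ℝ) : Prop where
  two_mul_lt : ∀ x, 2 * M < r x
  hasDerivAt : ∀ x, HasDerivAt r (1 - 2 * M / r x) x
  center : r xc = 3 * M

/-- `IsTortoiseRadius` is literally the conjunction used inline by the route items. [folklore] -/
theorem isTortoiseRadius_iff {M : ℝ} {r : ℝ → ℝ} {xc : ℝ} :
    IsTortoiseRadius M r xc ↔
      (∀ x, 2 * M < r x) ∧ (∀ x, HasDerivAt r (1 - 2 * M / r x) x) ∧ r xc = 3 * M :=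
  ⟨fun h ↦ ⟨h.1, h.2, h.3⟩, fun h ↦ ⟨h.1, h.2.1, h.2.2⟩⟩

namespace IsTortoiseRadius

variable {M : ℝ} {r : ℝ → ℝ} {xc : ℝ}

/-- The mass is positive (`2M < r(xc) = 3M`). [folklore] -/
theorem mass_pos (h : IsTortoiseRadius M r xc) : 0 < M := by
  have := h.two_mul_lt xc
  rw [h.center] at this
  linarith

/-- `r > 0`. [folklore] -/
theorem pos (h : IsTortoiseRadius M r xc) (x : ℝ) : 0 < r x := by
  have := h.two_mul_lt x
  have := h.mass_pos
  linarith

/-- `r − 2M > 0`. [folklore] -/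
theorem sub_pos (h : IsTortoiseRadius M r xc) (x : ℝ) : 0 < r x - 2 * M :=
  _root_.sub_pos.2 (h.two_mul_lt x)

/-- `0 < dr/dx = 1 − 2M/r`. [folklore] -/
theorem deriv_pos (h : IsTortoiseRadius M r xc) (x : ℝ) : 0 < 1 - 2 * M / r x := by
  rw [_root_.sub_pos, div_lt_one (h.pos x)]
  exact h.two_mul_lt x

/-- `dr/dx = 1 − 2M/r < 1`. [folklore] -/
theorem deriv_lt_one (h : IsTortoiseRadius M r xc) (x : ℝ) : 1 - 2 * M / r x < 1 := by
  have : 0 < 2 * M / r x := div_pos (by linarith [h.mass_pos]) (h.pos x)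
  linarith

/-- `r` is differentiable. [folklore] -/
theorem differentiable (h : IsTortoiseRadius M r xc) : Differentiable ℝ r := fun x ↦
  (h.hasDerivAt x).differentiableAt

/-- `r` is continuous. [folklore] -/
theorem continuous (h : IsTortoiseRadius M r xc) : Continuous r :=
  h.differentiable.continuous

/-- `deriv r = 1 − 2M/r`. [folklore] -/
theorem deriv_eq (h : IsTortoiseRadius M r xc) (x : ℝ) : deriv r x = 1 - 2 * M / r x :=
  (h.hasDerivAt x).deriv

/-- `r` is strictly increasing. [folklore] -/
theorem strictMono (h : IsTortoiseRadius M r xc) : StrictMono r :=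
  strictMono_of_deriv_pos fun x ↦ by rw [h.deriv_eq]; exact h.deriv_pos x

/-- `r` is `C¹` (indeed smooth; `C¹` is what the energy calculus uses). [folklore] -/
theorem contDiff_one (h : IsTortoiseRadius M r xc) : ContDiff ℝ 1 r := by
  rw [contDiff_one_iff_deriv]
  refine ⟨h.differentiable, ?_⟩
  have : deriv r = fun x ↦ 1 - 2 * M / r x := funext h.deriv_eq
  rw [this]
  exact continuous_const.sub (continuous_const.div h.continuous fun x ↦ (h.pos x).ne')

/-- `d/dx [r*(r(x))] = 1`. [folklore] -/
theorem hasDerivAt_tortoiseCoord_comp (h : IsTortoiseRadius M r xc) (x : ℝ) :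
    HasDerivAt (fun y ↦ tortoiseCoord M (r y)) 1 x := by
  have hr0 : r x ≠ 0 := (h.pos x).ne'
  have hr2 : r x - 2 * M ≠ 0 := (h.sub_pos x).ne'
  have hc := (hasDerivAt_tortoiseCoord M hr2).comp x (h.hasDerivAt x)
  refine hc.congr_deriv ?_
  field_simp
  ring

/-- **Tortoise identity**: `r*(r(x)) = x − xc`, i.e. `x − xc` is the normalised tortoise
coordinate of the sphere of area radius `r(x)`. [cite: DafermosRodnianski2008, App. F.2] -/
theorem tortoiseCoord_eq (h : IsTortoiseRadius M r xc) (x : ℝ) :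
    tortoiseCoord M (r x) = x - xc := by
  have hd : ∀ y, HasDerivAt (fun y ↦ tortoiseCoord M (r y) - y) 0 y := fun y ↦ by
    simpa using (h.hasDerivAt_tortoiseCoord_comp y).fun_sub (hasDerivAt_id' y)
  have hc := is_const_of_deriv_eq_zero (fun y ↦ (hd y).differentiableAt) (fun y ↦ (hd y).deriv)
    x xc
  simp only [h.center, tortoiseCoord_photonSphere] at hc
  linarith

/-- **Uniqueness** of the tortoise radius function with the photon sphere at `xc`. [folklore] -/
theorem unique {r₁ r₂ : ℝ → ℝ} (h₁ : IsTortoiseRadius M r₁ xc) (h₂ : IsTortoiseRadius M r₂ xc) :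
    r₁ = r₂ := by
  funext x
  refine injOn_tortoiseCoord h₁.mass_pos.le (h₁.two_mul_lt x) (h₂.two_mul_lt x) ?_
  rw [h₁.tortoiseCoord_eq, h₂.tortoiseCoord_eq]

/-- Moving the photon sphere: `x ↦ r(x − xc' + xc)` is the tortoise radius function centred at
`xc'`. [folklore] -/
theorem comp_sub_add (h : IsTortoiseRadius M r xc) (xc' : ℝ) :
    IsTortoiseRadius M (fun x ↦ r (x - xc' + xc)) xc' where
  two_mul_lt x := h.two_mul_lt _
  hasDerivAt x := by
    have hc := (h.hasDerivAt (x - xc' + xc)).comp x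
      (((hasDerivAt_id' x).sub_const xc').add_const xc)
    simpa [Function.comp_def] using hc
  center := by simp [h.center]

/-- `r(x) → +∞` as `x → +∞` (the tortoise line's right end is spatial/null infinity).
[cite: DafermosRodnianski2008, App. F.2] -/
theorem tendsto_atTop (h : IsTortoiseRadius M r xc) : Tendsto r atTop atTop := by
  have hM := h.mass_pos
  refine tendsto_atTop_atTop.2 fun b ↦ ⟨xc + tortoiseCoord M (max b (3 * M)), fun x hx ↦ ?_⟩
  have hB2 : 2 * M < max b (3 * M) := lt_of_lt_of_le (by linarith) (le_max_right _ _)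
  refine (le_max_left b (3 * M)).trans ?_
  by_contra hlt
  push Not at hlt
  have hmono := strictMonoOn_tortoiseCoord hM.le (h.two_mul_lt x) hB2 hlt
  rw [h.tortoiseCoord_eq] at hmono
  linarith

/-- `r(x) → 2M` as `x → −∞` (the tortoise line's left end is the event horizon).
[cite: DafermosRodnianski2008, App. F.2] -/
theorem tendsto_atBot (h : IsTortoiseRadius M r xc) : Tendsto r atBot (𝓝 (2 * M)) := by
  have hM := h.mass_pos
  refine tendsto_order.2 ⟨fun a ha ↦ Eventually.of_forall fun x ↦ ha.trans (h.two_mul_lt x),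
    fun b hb ↦ ?_⟩
  filter_upwards [eventually_lt_atBot (xc + tortoiseCoord M b)] with x hx
  by_contra hle
  push Not at hle
  have hmono := (strictMonoOn_tortoiseCoord hM.le).monotoneOn hb (h.two_mul_lt x) hle
  rw [h.tortoiseCoord_eq] at hmono
  linarith

end IsTortoiseRadius

/-! ### Existence: inverting `s ↦ r*(2M + eˢ)` -/

section Existence

variable {M : ℝ}

/-- The auxiliary map `g(s) = r*(2M + eˢ)`. [folklore] -/
def tortoiseAux (M s : ℝ) : ℝ := tortoiseCoord M (2 * M + Real.exp s)

/-- `g(s) = eˢ + 2Ms − M − 2M log M`. [folklore] -/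
theorem tortoiseAux_eq (M s : ℝ) :
    tortoiseAux M s = Real.exp s + 2 * M * s - M - 2 * M * Real.log M := by
  unfold tortoiseAux tortoiseCoord
  rw [show 2 * M + Real.exp s - 2 * M = Real.exp s by ring, Real.log_exp]
  ring

/-- `g` as an explicit function. [folklore] -/
theorem tortoiseAux_def (M : ℝ) :
    tortoiseAux M = fun s ↦ Real.exp s + 2 * M * s - M - 2 * M * Real.log M :=
  funext (tortoiseAux_eq M)

/-- `dg/ds = eˢ + 2M`. [folklore] -/
theorem hasDerivAt_tortoiseAux (M s : ℝ) : HasDerivAt (tortoiseAux M) (Real.exp s + 2 * M) s := by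
  have h := (((Real.hasDerivAt_exp s).add ((hasDerivAt_id' s).const_mul (2 * M))).sub_const M).sub_const
    (2 * M * Real.log M)
  rw [tortoiseAux_def]
  simpa using h

/-- `g` is strictly increasing (`M ≥ 0`). [folklore] -/
theorem strictMono_tortoiseAux (hM : 0 ≤ M) : StrictMono (tortoiseAux M) :=
  strictMono_of_deriv_pos fun s ↦ by
    rw [(hasDerivAt_tortoiseAux M s).deriv]
    exact add_pos_of_pos_of_nonneg (Real.exp_pos s) (by linarith)

/-- `g` is continuous. [folklore] -/
theorem continuous_tortoiseAux (M : ℝ) : Continuous (tortoiseAux M) :=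
  continuous_iff_continuousAt.2 fun s ↦ (hasDerivAt_tortoiseAux M s).continuousAt

/-- `g(s) → +∞` as `s → +∞` (`M ≥ 0`). [folklore] -/
theorem tendsto_tortoiseAux_atTop (hM : 0 ≤ M) : Tendsto (tortoiseAux M) atTop atTop := by
  rw [tortoiseAux_def]
  have h : Tendsto (fun s ↦ Real.exp s + (-M - 2 * M * Real.log M)) atTop atTop :=
    tendsto_atTop_add_const_right _ _ Real.tendsto_exp_atTop
  refine tendsto_atTop_mono' atTop ?_ h
  filter_upwards [eventually_ge_atTop (0 : ℝ)] with s hs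
  have : 0 ≤ 2 * M * s := by positivity
  linarith

/-- `g(s) → −∞` as `s → −∞` (`M > 0`). [folklore] -/
theorem tendsto_tortoiseAux_atBot (hM : 0 < M) : Tendsto (tortoiseAux M) atBot atBot := by
  rw [tortoiseAux_def]
  have h : Tendsto (fun s ↦ 2 * M * s + (1 - M - 2 * M * Real.log M)) atBot atBot :=
    tendsto_atBot_add_const_right _ _ (Tendsto.const_mul_atBot (by linarith) tendsto_id)
  refine tendsto_atBot_mono' atBot ?_ h
  filter_upwards [eventually_le_atBot (0 : ℝ)] with s hs
  have : Real.exp s ≤ 1 := Real.exp_le_one_iff.2 hs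
  linarith

/-- `g` is onto (`M > 0`). [folklore] -/
theorem surjective_tortoiseAux (hM : 0 < M) : Function.Surjective (tortoiseAux M) :=
  (continuous_tortoiseAux M).surjective (tendsto_tortoiseAux_atTop hM.le)
    (tendsto_tortoiseAux_atBot hM)

/-- The order isomorphism `g : ℝ ≃o ℝ` (`M > 0`). [folklore] -/
def tortoiseAuxIso (hM : 0 < M) : ℝ ≃o ℝ :=
  (strictMono_tortoiseAux hM.le).orderIsoOfSurjective _ (surjective_tortoiseAux hM)

/-- **The tortoise radius function with the photon sphere at `xc`**:
`r(x) = 2M + exp(g⁻¹(x − xc))`, the unique `ρ > 2M` with `r*(ρ) = x − xc`.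
[cite: DafermosRodnianski2008, App. F.2] -/
def tortoiseRadius (hM : 0 < M) (xc x : ℝ) : ℝ :=
  2 * M + Real.exp ((tortoiseAuxIso hM).symm (x - xc))

/-- `r*(r(x)) = x − xc` for the constructed `r`. [cite: DafermosRodnianski2008, App. F.2] -/
theorem tortoiseCoord_tortoiseRadius (hM : 0 < M) (xc x : ℝ) :
    tortoiseCoord M (tortoiseRadius hM xc x) = x - xc := by
  have h := (tortoiseAuxIso hM).apply_symm_apply (x - xc)
  rw [tortoiseAuxIso, StrictMono.coe_orderIsoOfSurjective] at h
  exact h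

/-- `r > 2M` for the constructed `r`. [folklore] -/
theorem two_mul_lt_tortoiseRadius (hM : 0 < M) (xc x : ℝ) : 2 * M < tortoiseRadius hM xc x :=
  lt_add_of_pos_right _ (Real.exp_pos _)

/-- **Existence of tortoise radius functions**: `tortoiseRadius hM xc` is one.
[cite: DafermosRodnianski2008, App. F.2] -/
theorem isTortoiseRadius_tortoiseRadius (hM : 0 < M) (xc : ℝ) :
    IsTortoiseRadius M (tortoiseRadius hM xc) xc := by
  set e := tortoiseAuxIso hM with he
  have hcoe : ∀ s, e s = tortoiseAux M s := fun s ↦ by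
    rw [he, tortoiseAuxIso, StrictMono.coe_orderIsoOfSurjective]
  have hsymm_cont : Continuous e.symm := e.symm.continuous
  -- derivative of the inverse bijection
  have hderiv_symm : ∀ y, HasDerivAt e.symm (Real.exp (e.symm y) + 2 * M)⁻¹ y := fun y ↦ by
    have hf := hasDerivAt_tortoiseAux M (e.symm y)
    have hne : Real.exp (e.symm y) + 2 * M ≠ 0 :=
      (add_pos_of_pos_of_nonneg (Real.exp_pos _) (by linarith)).ne'
    refine hf.of_local_left_inverse hsymm_cont.continuousAt hne ?_
    exact Eventually.of_forall fun z ↦ (hcoe (e.symm z)).symm.trans (e.apply_symm_apply z)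
  refine ⟨two_mul_lt_tortoiseRadius hM xc, fun x ↦ ?_, ?_⟩
  · have h1 := (hderiv_symm (x - xc)).comp x ((hasDerivAt_id' x).sub_const xc)
    have h2 := (h1.exp).const_add (2 * M)
    refine h2.congr_deriv ?_
    show Real.exp (e.symm (x - xc)) * ((Real.exp (e.symm (x - xc)) + 2 * M)⁻¹ * 1) =
      1 - 2 * M / (2 * M + Real.exp (e.symm (x - xc)))
    have hpos : 0 < Real.exp (e.symm (x - xc)) + 2 * M :=
      add_pos_of_pos_of_nonneg (Real.exp_pos _) (by linarith)
    field_simp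
    ring
  · have h1 : tortoiseCoord M (tortoiseRadius hM xc xc) = tortoiseCoord M (3 * M) := by
      rw [tortoiseCoord_tortoiseRadius, sub_self, tortoiseCoord_photonSphere]
    exact injOn_tortoiseCoord hM.le (two_mul_lt_tortoiseRadius hM xc xc)
      (show 2 * M < 3 * M by linarith) h1

/-- **Existence**: for every `M > 0` and every centre `xc` there is a tortoise radius function
with the photon sphere at `xc`. [cite: DafermosRodnianski2008, App. F.2] -/
theorem exists_isTortoiseRadius (hM : 0 < M) (xc : ℝ) : ∃ r, IsTortoiseRadius M r xc :=
  ⟨_, isTortoiseRadius_tortoiseRadius hM xc⟩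

/-- **Existence and uniqueness** of the tortoise radius function with the photon sphere at `xc`.
[cite: DafermosRodnianski2008, App. F.2] -/
theorem existsUnique_isTortoiseRadius (hM : 0 < M) (xc : ℝ) : ∃! r, IsTortoiseRadius M r xc :=
  ⟨_, isTortoiseRadius_tortoiseRadius hM xc,
    fun _ hr ↦ hr.unique (isTortoiseRadius_tortoiseRadius hM xc)⟩

/-- Every tortoise radius function **is** the constructed one. [folklore] -/
theorem IsTortoiseRadius.eq_tortoiseRadius {r : ℝ → ℝ} {xc : ℝ} (h : IsTortoiseRadius M r xc) :
    r = tortoiseRadius h.mass_pos xc :=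
  h.unique (isTortoiseRadius_tortoiseRadius h.mass_pos xc)

/-- The range of a tortoise radius function is exactly `(2M, ∞)`. [folklore] -/
theorem IsTortoiseRadius.range_eq {r : ℝ → ℝ} {xc : ℝ} (h : IsTortoiseRadius M r xc) :
    range r = Ioi (2 * M) := by
  refine Subset.antisymm (range_subset_iff.2 fun x ↦ h.two_mul_lt x) fun ρ hρ ↦ ?_
  refine ⟨xc + tortoiseCoord M ρ, injOn_tortoiseCoord h.mass_pos.le (h.two_mul_lt _) hρ ?_⟩
  rw [h.tortoiseCoord_eq]
  ring

end Existence

end ReggeWheeler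

end Literature.Geometry.Lorentzian
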